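import Summits.AtomisticToContinuum.Crystallization.Theses.PalmUnimodularRigidity
import Summits.AtomisticToContinuum.Crystallization.Theorems.MinimiserShells.Negative.LoadBearing
import Summits.AtomisticToContinuum.Crystallization.Theorems.MinimiserShells.Negative.Rootedness
import Summits.AtomisticToContinuum.Crystallization.Theorems.PalmUnimodularRigidityMinimiserShellsEquilibriumInLawPhase
import Literature.Probability.Process.PointStationaryLaw
import Literature.MathematicalPhysics.StatisticalMechanics.RootEnergy
import Literature.MathematicalPhysics.StatisticalMechanics.MuGSC

/-!
# The random grid, II: lattice periodicity, the shift lemma, and phase volumes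

Helper file for stub `stub_equilibriumInLaw` (S1) of line `equilibrium-in-law-surgery`, crux
`MinimiserShells` (stmt-AtomisticToContinuum-9225): second half of the deterministic grid lemmas
(blueprint 9–10), continuing `…EquilibriumInLawPhase`.

* periodicity under the lattice `Lℤ³ = span ℤ (L e_i)` (`latticeL`, `mem_latticeL_iff`,
  `cell_add_of_mem_latticeL`, `depth_add_of_mem_latticeL`);
* the phase cube is a `ZSpan` fundamental domain (`isAddFundamentalDomain_cube`), and the SHIFT
  LEMMA `setLIntegral_cube_add_right`: `∫_{cube} G(u + y) du = ∫_{cube} G(u) du` for every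
  lattice-periodic `G ≥ 0` (translation invariance of Lebesgue measure + two fundamental domains);
* phase volumes: `volume (cube L) = L³`, coordinate slabs (`volume_slab_le`), and the thin
  boundary layers `volume {u ∈ cube | depth u ∈ [a, b]} ≤ 6 (b − a) L²` (`volume_depth_mem_Icc_le`).
-/

noncomputable section

open MeasureTheory
open scoped ENNReal BigOperators Pointwise

namespace Summit.AtomisticToContinuum.Crystallization.Theorems.PalmUnimodularRigidityMinimiserShells.EquilibriumInLaw.Lattice

open Literature.Probability.Process (IsPointStationaryLaw IsRootedHardCore count_restrict_singleton_ne_zero_iff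
  map_sub_count_restrict)
open Literature.MathematicalPhysics.StatisticalMechanics (lennardJones IsMuGSC UniformlyDiscrete)
open Summit.AtomisticToContinuum.Crystallization.Theses.PalmUnimodularRigidity (MinimiserShells UnimodularEnergyLowerBound)
open Summit.AtomisticToContinuum.Crystallization.Theorems.MinimiserShells.Negative.LoadBearing
  (eStar meanRootEnergy GoodShell minimiserShells_iff)
open Summit.AtomisticToContinuum.Crystallization.Theorems.MinimiserShells.Negative.Rootedness (E3)
open Summit.AtomisticToContinuum.Crystallization.Theorems.PalmUnimodularRigidityMinimiserShells.EquilibriumInLaw.Phase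

/-! ## Periodicity under the lattice `Lℤ³` -/

/-- The basis `(L e_i)_i` of `ℝ³`. -/
def basisL {L : ℝ} (hL : L ≠ 0) : Module.Basis (Fin 3) ℝ E3 :=
  (EuclideanSpace.basisFun (Fin 3) ℝ).toBasis.unitsSMul fun _ => Units.mk0 L hL

/-- Coordinates in the basis `(L e_i)`: `u_i / L`. -/
theorem basisL_repr {L : ℝ} (hL : L ≠ 0) (u : E3) (i : Fin 3) : (basisL hL).repr u i = L⁻¹ * u i := by
  simp [basisL, Module.Basis.repr_unitsSMul, Units.smul_def]

/-- The lattice `Lℤ³` as an additive subgroup of `ℝ³`. -/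
def latticeL {L : ℝ} (hL : L ≠ 0) : AddSubgroup E3 :=
  (Submodule.span ℤ (Set.range (basisL hL))).toAddSubgroup

/-- The lattice is countable. -/
instance countable_latticeL {L : ℝ} (hL : L ≠ 0) : Countable (latticeL hL) :=
  inferInstanceAs (Countable (Submodule.span ℤ (Set.range (basisL hL))))

/-- Membership in the lattice: all coordinates are integer multiples of `L`. -/
theorem mem_latticeL_iff {L : ℝ} (hL : L ≠ 0) (v : E3) :
    v ∈ latticeL hL ↔ ∀ i, ∃ m : ℤ, v i = L * m := by
  have key : v ∈ latticeL hL ↔ ∀ i, ∃ m : ℤ, (m : ℝ) = L⁻¹ * v i := by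
    rw [latticeL, Submodule.mem_toAddSubgroup, Module.Basis.mem_span_iff_repr_mem]
    simp [basisL_repr]
  rw [key]
  refine forall_congr' fun i => exists_congr fun m => ?_
  constructor
  · intro hm
    have : L * m = L * (L⁻¹ * v i) := by rw [hm]
    rwa [mul_inv_cancel_left₀ hL, eq_comm] at this
  · intro hm
    rw [hm, inv_mul_cancel_left₀ hL]

/-- The cell index shifts by an integer vector under a lattice translation of the phase. -/
theorem cellIdx_add_of_mem_latticeL {L : ℝ} (hL : L ≠ 0) {v : E3} (hv : v ∈ latticeL hL) (u z : E3)
    (i : Fin 3) : ∃ m : ℤ, v i = L * m ∧ cellIdx L (u + v) z i = cellIdx L u z i - m := by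
  obtain ⟨m, hm⟩ := (mem_latticeL_iff hL v).1 hv i
  refine ⟨m, hm, ?_⟩
  simp only [cellIdx]
  have : (z i - (u + v) i) / L = (z i - u i) / L - m := by
    change (z i - (u i + v i)) / L = _
    rw [hm]; field_simp; ring
  rw [this, Int.floor_sub_intCast]

/-- **Cells are lattice-periodic in the phase.** -/
theorem cell_add_of_mem_latticeL {L : ℝ} (hL : L ≠ 0) {v : E3} (hv : v ∈ latticeL hL) (u : E3) :
    cell L (u + v) = cell L u := by
  ext z
  simp only [cell, Set.mem_setOf_eq]
  refine forall_congr' fun i => ?_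
  obtain ⟨m, -, h1⟩ := cellIdx_add_of_mem_latticeL hL hv u z i
  obtain ⟨m', hm', h2⟩ := cellIdx_add_of_mem_latticeL hL hv u 0 i
  obtain ⟨m'', hm'', -⟩ := cellIdx_add_of_mem_latticeL hL hv u z i
  have hmm : m = m' := by
    obtain ⟨m₀, hm₀, h1'⟩ := cellIdx_add_of_mem_latticeL hL hv u z i
    have e1 : (m₀ : ℝ) = m' := by
      have := hm₀.symm.trans hm'
      exact_mod_cast (mul_right_injective₀ hL) this
    have e2 : m₀ = m := by
      have := h1'.symm.trans h1
      omega
    exact_mod_cast e2.symm.trans (by exact_mod_cast e1 : m₀ = m')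
  rw [h1, h2, hmm]
  omega

/-- **The depth is lattice-periodic in the phase.** -/
theorem depth_add_of_mem_latticeL {L : ℝ} (hL : L ≠ 0) {v : E3} (hv : v ∈ latticeL hL) (u : E3) :
    depth L (u + v) = depth L u := by
  have : ∀ i, coordDepth L (u + v) i = coordDepth L u i := by
    intro i
    obtain ⟨m, hm⟩ := (mem_latticeL_iff hL v).1 hv i
    simp only [coordDepth]
    have : (u + v) i / L = u i / L + m := by
      change (u i + v i) / L = _
      rw [hm]; field_simp
    rw [this, Int.fract_add_intCast]
  simp only [depth, this]

/-! ## The cube is a fundamental domain; the shift lemma -/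

/-- The phase cube is the `ZSpan` fundamental domain of the basis `(L e_i)`. -/
theorem fundamentalDomain_basisL {L : ℝ} (hL : 0 < L) : ZSpan.fundamentalDomain (basisL hL.ne') = cube L := by
  ext u
  simp only [ZSpan.mem_fundamentalDomain, basisL_repr, cube, Set.mem_setOf_eq, Set.mem_Ico]
  refine forall_congr' fun i => ?_
  rw [inv_mul_eq_div, le_div_iff₀ hL, div_lt_iff₀ hL, zero_mul, one_mul]

/-- **The phase cube is a fundamental domain** for the lattice `Lℤ³` (Lebesgue measure). -/
theorem isAddFundamentalDomain_cube {L : ℝ} (hL : 0 < L) :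
    IsAddFundamentalDomain (latticeL hL.ne') (cube L) (volume : Measure E3) := by
  rw [← fundamentalDomain_basisL hL]
  exact ZSpan.isAddFundamentalDomain' (basisL hL.ne') volume

/-- **Shift lemma.** For a lattice-periodic `G ≥ 0` (no measurability needed) and every `y`:
`∫_{cube} G(u + y) du = ∫_{cube} G(u) du`. -/
theorem setLIntegral_cube_add_right {L : ℝ} (hL : 0 < L) {G : E3 → ℝ≥0∞}
    (hper : ∀ v ∈ latticeL hL.ne', ∀ u, G (u + v) = G u) (y : E3) :
    ∫⁻ u in cube L, G (u + y) = ∫⁻ u in cube L, G u := by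
  have hfd := isAddFundamentalDomain_cube hL
  have hfd' : IsAddFundamentalDomain (latticeL hL.ne') (y +ᵥ cube L) (volume : Measure E3) :=
    hfd.vadd_of_comm y
  have hinv : ∀ (g : latticeL hL.ne') (u : E3), G (g +ᵥ u) = G u := by
    intro g u
    rw [AddSubgroup.vadd_def, vadd_eq_add, add_comm]
    exact hper g g.2 u
  -- translate: `∫_{cube} G(u + y) du = ∫_{y + cube} G`
  have hmeas : MeasurableSet (y +ᵥ cube L) := (measurableSet_cube L).const_vadd y
  have step : ∫⁻ u in cube L, G (u + y) = ∫⁻ u in y +ᵥ cube L, G u := by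
    rw [← lintegral_indicator (measurableSet_cube L), ← lintegral_indicator hmeas,
      ← lintegral_add_right_eq_self (fun u => (y +ᵥ cube L).indicator G u) y]
    congr 1
    funext u
    change (cube L).indicator (fun u => G (u + y)) u = (y +ᵥ cube L).indicator G (u + y)
    have hiff : u + y ∈ y +ᵥ cube L ↔ u ∈ cube L := by
      rw [Set.mem_vadd_set_iff_neg_vadd_mem, vadd_eq_add, neg_add_cancel_comm_assoc]
    by_cases hu : u ∈ cube L
    · rw [Set.indicator_of_mem hu, Set.indicator_of_mem (hiff.2 hu)]
    · rw [Set.indicator_of_notMem hu, Set.indicator_of_notMem fun h => hu (hiff.1 h)]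
  rw [step]
  exact hfd'.setLIntegral_eq hfd G hinv

/-! ## Phase volumes -/

/-- The cube as a preimage of a coordinate box. -/
theorem cube_eq_preimage (L : ℝ) :
    cube L = (WithLp.ofLp : E3 → Fin 3 → ℝ) ⁻¹' Set.pi Set.univ fun _ => Set.Ico 0 L := by
  ext u; simp [cube]

/-- `volume (cube L) = L³`. -/
theorem volume_cube {L : ℝ} (hL : 0 ≤ L) : volume (cube L) = ENNReal.ofReal (L ^ 3) := by
  rw [cube_eq_preimage, (PiLp.volume_preserving_ofLp (Fin 3)).measure_preimage
    (MeasurableSet.univ_pi fun _ => measurableSet_Ico).nullMeasurableSet, volume_pi_pi]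
  simp only [Real.volume_Ico, sub_zero, Finset.prod_const, Finset.card_univ, Fintype.card_fin]
  rw [← ENNReal.ofReal_pow hL]

/-- A coordinate slab of the cube has volume at most `vol(A) · L²`. -/
theorem volume_slab_le (L : ℝ) (i : Fin 3) {A : Set ℝ} (hA : MeasurableSet A) :
    volume {u : E3 | u ∈ cube L ∧ u i ∈ A} ≤ volume A * ENNReal.ofReal L ^ 2 := by
  classical
  set s : Fin 3 → Set ℝ := Function.update (fun _ => Set.Ico 0 L) i (Set.Ico 0 L ∩ A) with hs
  have hrepr : {u : E3 | u ∈ cube L ∧ u i ∈ A} = (WithLp.ofLp : E3 → Fin 3 → ℝ) ⁻¹' Set.pi Set.univ s := by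
    ext u
    simp only [Set.mem_setOf_eq, cube, Set.mem_preimage, Set.mem_univ_pi, hs]
    constructor
    · rintro ⟨hc, ha⟩ j
      by_cases hj : j = i
      · subst hj; rw [Function.update_self]; exact ⟨hc j, ha⟩
      · rw [Function.update_of_ne hj]; exact hc j
    · intro h
      refine ⟨fun j => ?_, ?_⟩
      · by_cases hj : j = i
        · subst hj; have := h j; rw [Function.update_self] at this; exact this.1
        · have := h j; rwa [Function.update_of_ne hj] at this
      · have := h i; rw [Function.update_self] at this; exact this.2
  have hsm : ∀ j, MeasurableSet (s j) := fun j => by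
    by_cases hj : j = i
    · subst hj; rw [hs, Function.update_self]; exact measurableSet_Ico.inter hA
    · rw [hs, Function.update_of_ne hj]; exact measurableSet_Ico
  rw [hrepr, (PiLp.volume_preserving_ofLp (Fin 3)).measure_preimage
    (MeasurableSet.univ_pi hsm).nullMeasurableSet, volume_pi_pi,
    ← Finset.mul_prod_erase _ _ (Finset.mem_univ i)]
  have h1 : volume (s i) ≤ volume A := by
    rw [hs, Function.update_self]; exact measure_mono Set.inter_subset_right
  have h2 : ∏ j ∈ Finset.univ.erase i, volume (s j) = ENNReal.ofReal L ^ 2 := by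
    rw [Finset.prod_congr rfl fun j hj => by
      rw [hs, Function.update_of_ne (Finset.ne_of_mem_erase hj), Real.volume_Ico, sub_zero]]
    rw [Finset.prod_const, Finset.card_erase_of_mem (Finset.mem_univ i), Finset.card_univ,
      Fintype.card_fin]
  rw [h2]
  gcongr

/-- On the cube the coordinate depth is `min(u_i, L − u_i)`. -/
theorem coordDepth_of_mem_cube {L : ℝ} (hL : 0 < L) {u : E3} (hu : u ∈ cube L) (i : Fin 3) :
    coordDepth L u i = min (u i) (L - u i) := by
  have h := hu i
  have hf : Int.fract (u i / L) = u i / L := by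
    rw [Int.fract_eq_iff]
    refine ⟨div_nonneg h.1 hL.le, (div_lt_one hL).2 h.2, ⟨0, by simp⟩⟩
  unfold coordDepth
  rw [hf, mul_div_cancel₀ _ hL.ne']

/-- **Boundary layers are thin**: `volume {u ∈ cube | depth u ∈ [a, b]} ≤ 6 (b − a) L²`. -/
theorem volume_depth_mem_Icc_le {L : ℝ} (hL : 0 < L) {a b : ℝ} (hab : a ≤ b) :
    volume {u : E3 | u ∈ cube L ∧ depth L u ∈ Set.Icc a b} ≤ ENNReal.ofReal (6 * (b - a) * L ^ 2) := by
  have hsub : {u : E3 | u ∈ cube L ∧ depth L u ∈ Set.Icc a b} ⊆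
      ⋃ i : Fin 3, ({u : E3 | u ∈ cube L ∧ u i ∈ Set.Icc a b} ∪
        {u : E3 | u ∈ cube L ∧ u i ∈ Set.Icc (L - b) (L - a)}) := by
    rintro u ⟨hu, hd⟩
    obtain ⟨i, hi⟩ := exists_depth_eq_coordDepth L u
    rw [hi, coordDepth_of_mem_cube hL hu i] at hd
    refine Set.mem_iUnion.2 ⟨i, ?_⟩
    rcases min_choice (u i) (L - u i) with h | h <;> rw [h] at hd
    · exact Or.inl ⟨hu, hd⟩
    · right
      refine ⟨hu, ?_, ?_⟩ <;> linarith [hd.1, hd.2]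
  have hvol : ∀ i : Fin 3, volume ({u : E3 | u ∈ cube L ∧ u i ∈ Set.Icc a b} ∪
      {u : E3 | u ∈ cube L ∧ u i ∈ Set.Icc (L - b) (L - a)}) ≤ ENNReal.ofReal (2 * (b - a) * L ^ 2) := by
    intro i
    calc _ ≤ volume {u : E3 | u ∈ cube L ∧ u i ∈ Set.Icc a b} +
          volume {u : E3 | u ∈ cube L ∧ u i ∈ Set.Icc (L - b) (L - a)} := measure_union_le _ _
      _ ≤ volume (Set.Icc a b) * ENNReal.ofReal L ^ 2 +
          volume (Set.Icc (L - b) (L - a)) * ENNReal.ofReal L ^ 2 :=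
          add_le_add (volume_slab_le L i measurableSet_Icc) (volume_slab_le L i measurableSet_Icc)
      _ = ENNReal.ofReal (2 * (b - a) * L ^ 2) := by
          rw [Real.volume_Icc, Real.volume_Icc, show L - a - (L - b) = b - a by ring, ← two_mul,
            ← ENNReal.ofReal_pow hL.le, ← ENNReal.ofReal_mul (by linarith), ← ENNReal.ofReal_ofNat,
            ← ENNReal.ofReal_mul (by norm_num)]
          ring_nf
  calc volume {u : E3 | u ∈ cube L ∧ depth L u ∈ Set.Icc a b}
      ≤ volume (⋃ i : Fin 3, ({u : E3 | u ∈ cube L ∧ u i ∈ Set.Icc a b} ∪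
          {u : E3 | u ∈ cube L ∧ u i ∈ Set.Icc (L - b) (L - a)})) := measure_mono hsub
    _ ≤ ∑ i : Fin 3, volume ({u : E3 | u ∈ cube L ∧ u i ∈ Set.Icc a b} ∪
          {u : E3 | u ∈ cube L ∧ u i ∈ Set.Icc (L - b) (L - a)}) := measure_iUnion_fintype_le _ _
    _ ≤ ∑ _i : Fin 3, ENNReal.ofReal (2 * (b - a) * L ^ 2) := Finset.sum_le_sum fun i _ => hvol i
    _ = ENNReal.ofReal (6 * (b - a) * L ^ 2) := by
        rw [Finset.sum_const, Finset.card_univ, Fintype.card_fin, nsmul_eq_mul, Nat.cast_ofNat,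
          ← ENNReal.ofReal_ofNat, ← ENNReal.ofReal_mul (by norm_num)]
        ring_nf

/-- Registered stub marker (helper part 9/14 of `stub_equilibriumInLaw`, line `equilibrium-in-law-surgery`):
the phase-shift lemma `setLIntegral_cube_add_right`, closed form. -/
theorem stub_equilibriumInLaw_part09 :
    ∀ (L : ℝ) (hL : 0 < L) (G : EuclideanSpace ℝ (Fin 3) → ℝ≥0∞),
      (∀ v ∈ latticeL hL.ne', ∀ u, G (u + v) = G u) →
      ∀ y, ∫⁻ u in cube L, G (u + y) = ∫⁻ u in cube L, G u :=
  fun _ hL _ hper y => setLIntegral_cube_add_right hL hper y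

end Summit.AtomisticToContinuum.Crystallization.Theorems.PalmUnimodularRigidityMinimiserShells.EquilibriumInLaw.Lattice

end
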